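import Literature.Barriers.CriticalPhenomena.PlaquetteWalkQuadrantLaw
import Literature.Barriers.CriticalPhenomena.PlaquetteWalkRowLawEveryCell
import HarnessLib

/-!
# Barrier catalogue (SAWScalingLimit): the EAST HALF-PLANE LAW of a `W`-rooted hole — one statement for every cell east of the root column, with the natural
zero-count bound («EAST HALF-PLANE LAW»)

`Z → ∞` limit model of the printed Yang–Baxter weights [GlazmanManolescu2019, §1, eq. (1)]; the «RECTANGLE COEFFICIENT» line of the venture lane «pcv-sawmu»
(b-engine-1 g27). §1: the exponent budget is reflection invariant — the total weight exponent of a walk is invariant under the row reflection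
(`totalExp_map_mirrorRow`: corner ↔ co-corner), the reflection is a bijection of walks (`MirrorWalk.mirrorWalk`), hence ★ `maxExp_map_mirrorRowFace :
maxExp(ρDl, ρa, ρf₀) = maxExp(Dl, a, f₀)`, so the laws BELOW the root row (`PlaquetteWalkHoleRootColumnLawBelow`, `PlaquetteWalkQuadrantLaw`, stated with the
budget of the reflected list) hold with the bound `4·maxExp(Dl) − 4` of the configuration itself (`…_of_mirrorRow'`, `…_of_colFrame_below'`). §2: packaging of
`PlaquetteWalkRowLawEveryCell` (root row, `y = 0`) and `PlaquetteWalkQuadrantLaw` (above, `y ≥ 1`; below, `y ≤ −1`): for the hole root in the `W`-normalisation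
(root on the `W` side of `w`, hole `(w.1 − 1, w.2)`) and EVERY cell `(w.1 + k, w.2 + y)`, `k ≥ 0`, `y ∈ ℤ` — exactly the cells at which the lane's census finds
cost-`5` members (FINDING-YB-LEVEL5-PHASE-LAW §3: all `6 784` such cells have `rel.x ≥ 0`) — the printed vertex functional is NOT identically zero on `(0, π)`,
with at most `4·maxExp(Dl) − 4` zeros, as soon as the explicit frame `eastFrame w k y` of the census member fits in the face list and the hole is absent
(★★★★★ `vertexFunctional_printed_exists_ne_zero_of_eastFrame`, `vertexFunctional_printed_zero_set_finite_of_eastFrame`).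
[GlazmanManolescu2019 §1 Fig. 1, eq. (1) and the remark after it (θ ↔ π − θ), Lemma 2.1, Remark 2.2, §4.2 (lattice symmetries); Glazman2015WeightedSAW Lemma 3.1
(proof, pp. 6–7); CourantRobbins1958 Ch. V App. §2]
-/

noncomputable section

open Set Function Complex

namespace Literature.Barriers.CriticalPhenomena.PlaquetteWalk

open Literature.Probability.RandomPlanarGeometry.SAW.YangBaxter
open Real Complex

/-! ## §1 The exponent budget under the row reflection -/

/-- The total weight exponent of a mid-edge list is reflection invariant (corner ↔ co-corner). [cite: GlazmanManolescu2019, §1, eq. (1) and the remark after it (θ ↔ π − θ)] -/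
theorem totalExp_map_mirrorRow (c : ℤ) (l : List MidEdge) : totalExp (l.map (mirrorRow c)) = totalExp l := by
  unfold totalExp
  simp only [cfgCount_map_mirrorRow, List.map_cons, List.map_nil, mirrorKind]
  ring

/-- The largest exponent of a walk between two mid-edges is reflection invariant. [cite: GlazmanManolescu2019, §2.1, eq. (2.1); §4.2 (lattice symmetries)] -/
theorem maxExpTo_map_mirrorRowFace (c : ℤ) (Dl : List Face) (a z : MidEdge) :
    maxExpTo (Dl.map (mirrorRowFace c)) (mirrorRow c a) (mirrorRow c z) = maxExpTo Dl a z := by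
  unfold maxExpTo
  have hD : ∀ f, f ∈ dom (Dl.map (mirrorRowFace c)) → mirrorRowFace c f ∈ dom Dl := fun f hf => (mem_dom_map_mirrorRowFace c Dl f).1 hf
  have hD' : ∀ f, f ∈ dom Dl → mirrorRowFace c f ∈ dom (Dl.map (mirrorRowFace c)) := fun f hf =>
    (mem_dom_map_mirrorRowFace c Dl _).2 (by rwa [mirrorRowFace_mirrorRowFace])
  apply le_antisymm
  · refine Finset.sup_le fun γ _ => ?_
    have e : totalExp γ.mids = totalExp (MirrorWalk.mirrorWalk c hD (mirrorRow_mirrorRow c a) (mirrorRow_mirrorRow c z) γ).mids := by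
      rw [MirrorWalk.mirrorWalk_mids, totalExp_map_mirrorRow]
    rw [e]
    exact Finset.le_sup (f := fun δ : YBWalk (dom Dl) a z => totalExp δ.mids) (Finset.mem_univ _)
  · refine Finset.sup_le fun γ _ => ?_
    have e : totalExp γ.mids = totalExp (MirrorWalk.mirrorWalk c hD' rfl rfl γ).mids := by
      rw [MirrorWalk.mirrorWalk_mids, totalExp_map_mirrorRow]
    rw [e]
    exact Finset.le_sup (f := fun δ : YBWalk (dom (Dl.map (mirrorRowFace c))) (mirrorRow c a) (mirrorRow c z) => totalExp δ.mids) (Finset.mem_univ _)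

/-- The four slots of the reflected rhombus are the reflected slots, `N ↔ S`. [cite: GlazmanManolescu2019, §4.2 (lattice symmetries)] -/
theorem slotSide_mirrorRowFace (c : ℤ) (f₀ : Face) (s : Fin 4) :
    ∃ t : Fin 4, slotSide (mirrorRowFace c f₀) s = mirrorRow c (slotSide f₀ t) ∧ slotSide (mirrorRowFace c f₀) t = mirrorRow c (slotSide f₀ s) := by
  fin_cases s
  · exact ⟨0, by simp [slotSide, mirrorRow_side, mirrorSide]⟩
  · exact ⟨3, by simp [slotSide, mirrorRow_side, mirrorSide]⟩
  · exact ⟨2, by simp [slotSide, mirrorRow_side, mirrorSide]⟩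
  · exact ⟨1, by simp [slotSide, mirrorRow_side, mirrorSide]⟩

/-- ★ **THE EXPONENT BUDGET IS MIRROR INVARIANT**: `maxExp(ρDl, ρa, ρf₀) = maxExp(Dl, a, f₀)`. [cite: GlazmanManolescu2019, Lemma 2.1; §4.2 (lattice symmetries)] -/
theorem maxExp_map_mirrorRowFace (c : ℤ) (Dl : List Face) (a : MidEdge) (f₀ : Face) :
    maxExp (Dl.map (mirrorRowFace c)) (mirrorRow c a) (mirrorRowFace c f₀) = maxExp Dl a f₀ := by
  unfold maxExp
  apply le_antisymm
  · refine Finset.sup_le fun s _ => ?_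
    obtain ⟨t, ht, -⟩ := slotSide_mirrorRowFace c f₀ s
    rw [ht, maxExpTo_map_mirrorRowFace]
    exact Finset.le_sup (f := fun t : Fin 4 => maxExpTo Dl a (slotSide f₀ t)) (Finset.mem_univ t)
  · refine Finset.sup_le fun s _ => ?_
    obtain ⟨t, -, ht⟩ := slotSide_mirrorRowFace c f₀ s
    rw [← maxExpTo_map_mirrorRowFace c, ← ht]
    exact Finset.le_sup (f := fun t : Fin 4 => maxExpTo (Dl.map (mirrorRowFace c)) (mirrorRow c a) (slotSide (mirrorRowFace c f₀) t)) (Finset.mem_univ t)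

/-- The exponent budget at a `W`-rooted hole, reflected configuration versus configuration. [cite: GlazmanManolescu2019, Lemma 2.1; §4.2 (lattice symmetries)] -/
theorem maxExp_map_mirrorRowFace_root (Dl : List Face) (w f₀ : Face) :
    maxExp (Dl.map (mirrorRowFace w.2)) (w.side .W) (mirrorRowFace w.2 f₀) = maxExp Dl (w.side .W) f₀ := by
  conv_lhs => rw [← mirrorRow_root w]
  exact maxExp_map_mirrorRowFace _ _ _ _

/-! ### The laws below the root row with the natural bound -/

variable {Dl : List Face} {w : Face}

/-- ★★★ **FINITE ZERO SETS REFLECT, SAME BOUND**: a finite zero set with the standard bound `4·maxExp − 4` for the reflected configuration gives the same for the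
configuration, with ITS OWN exponent budget. [cite: GlazmanManolescu2019, Lemma 2.1, eq. (CR); §4.2 (lattice symmetries)] -/
theorem vertexFunctional_printed_zero_set_finite_of_mirrorRow' {f₀ : Face}
    (h : {θ ∈ Set.Ioo 0 π | vertexFunctional (printedWeights θ) tFiveEighths (ybCoeff θ) (Dl.map (mirrorRowFace w.2)) (w.side .W)
        (mirrorRowFace w.2 f₀) = 0}.Finite ∧
      {θ ∈ Set.Ioo 0 π | vertexFunctional (printedWeights θ) tFiveEighths (ybCoeff θ) (Dl.map (mirrorRowFace w.2)) (w.side .W)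
        (mirrorRowFace w.2 f₀) = 0}.ncard ≤ 4 * maxExp (Dl.map (mirrorRowFace w.2)) (w.side .W) (mirrorRowFace w.2 f₀) + 1 - 5) :
    {θ ∈ Set.Ioo 0 π | vertexFunctional (printedWeights θ) tFiveEighths (ybCoeff θ) Dl (w.side .W) f₀ = 0}.Finite ∧
      {θ ∈ Set.Ioo 0 π | vertexFunctional (printedWeights θ) tFiveEighths (ybCoeff θ) Dl (w.side .W) f₀ = 0}.ncard ≤ 4 * maxExp Dl (w.side .W) f₀ + 1 - 5 := by
  rw [maxExp_map_mirrorRowFace_root] at h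
  exact vertexFunctional_printed_zero_set_finite_of_mirrorRow h

/-- ★★★★★ **THE QUADRANT LAW BELOW THE ROOT ROW, natural bound**: for every `k ≥ 0`, `y ≥ 1` and every finite face list missing the hole and containing the reflected
frame `(colFrame w k y).map ρ`, the printed vertex functional at `(w.1 + k, w.2 − y)` has finitely many zeros in `(0, π)`, at most `4·maxExp(Dl) − 4`.
[cite: GlazmanManolescu2019, Lemma 2.1 and eq. (1); Remark 2.2; §4.2 (lattice symmetries)] [cite: Glazman2015WeightedSAW, Lemma 3.1 (proof, pp. 6–7)] -/
theorem vertexFunctional_printed_zero_set_finite_of_colFrame_below' {k y : ℕ} (hy : 1 ≤ y) (hh : holeFaceW w ∉ dom Dl)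
    (hB : ∀ c ∈ (colFrame w k y).map (mirrorRowFace w.2), c ∈ Dl) (hr : RootedFace (dom Dl) (w.side .W) (w.1 + k, w.2 - y)) :
    {θ ∈ Set.Ioo 0 π | vertexFunctional (printedWeights θ) tFiveEighths (ybCoeff θ) Dl (w.side .W) (w.1 + k, w.2 - y) = 0}.Finite ∧
      {θ ∈ Set.Ioo 0 π | vertexFunctional (printedWeights θ) tFiveEighths (ybCoeff θ) Dl (w.side .W) (w.1 + k, w.2 - y) = 0}.ncard ≤
        4 * maxExp Dl (w.side .W) (w.1 + k, w.2 - y) + 1 - 5 := by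
  have h := vertexFunctional_printed_zero_set_finite_of_colFrame_below hy hh hB hr
  rwa [← mirrorRowFace_below w k y, maxExp_map_mirrorRowFace_root] at h

/-! ## §2 The east half-plane law, every cell -/

/-- The frame of the census member at the cell `(w.1 + k, w.2 + y)`: the root-row frame for `y = 0`, the column frame for `y ≥ 1`, its row reflection for `y ≤ −1`.
[cite: GlazmanManolescu2019, §2.1 (finite domains of faces), §4.2 (lattice symmetries)] -/
def eastFrame (w : Face) (k : ℕ) (y : ℤ) : List Face :=
  if y = 0 then rowFrame w k else if 0 < y then colFrame w k y.toNat else (colFrame w k (-y).toNat).map (mirrorRowFace w.2)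

/-- ★★★★★ **THE EAST HALF-PLANE LAW.** For every `k ≥ 0`, `y ∈ ℤ` and every finite face list `Dl` missing the hole `(w.1 − 1, w.2)` and containing the frame
`eastFrame w k y`, the printed Yang–Baxter vertex functional at the root `w.side W` and the rhombus `(w.1 + k, w.2 + y)` is not identically zero on `(0, π)`.
[cite: GlazmanManolescu2019, Lemma 2.1 and eq. (1); Remark 2.2; §4.2] [cite: Glazman2015WeightedSAW, Lemma 3.1 (proof, pp. 6–7)]
[cite: CourantRobbins1958, Ch. V Appendix §2 (the even–odd rule)] -/
theorem vertexFunctional_printed_exists_ne_zero_of_eastFrame {k : ℕ} {y : ℤ} (hh : holeFaceW w ∉ dom Dl) (hB : ∀ c ∈ eastFrame w k y, c ∈ Dl)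
    (hr : RootedFace (dom Dl) (w.side .W) (w.1 + k, w.2 + y)) :
    ∃ θ ∈ Set.Ioo 0 π, vertexFunctional (printedWeights θ) tFiveEighths (ybCoeff θ) Dl (w.side .W) (w.1 + k, w.2 + y) ≠ 0 := by
  unfold eastFrame at hB
  rcases lt_trichotomy y 0 with hy | rfl | hy
  · rw [if_neg hy.ne, if_neg (not_lt.2 hy.le)] at hB
    have e : (w.2 + y : ℤ) = w.2 - ((-y).toNat : ℕ) := by rw [Int.toNat_of_nonneg (by omega)]; ring
    have e' : ((w.1 + k, w.2 + y) : Face) = (w.1 + k, w.2 - ((-y).toNat : ℕ)) := Prod.ext rfl e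
    rw [e'] at hr ⊢
    exact vertexFunctional_printed_exists_ne_zero_of_colFrame_below (by omega) hh hB hr
  · rw [if_pos rfl] at hB
    have e' : ((w.1 + k, w.2 + (0 : ℤ)) : Face) = (w.1 + k, w.2) := Prod.ext rfl (add_zero _)
    rw [e'] at hr ⊢
    exact vertexFunctional_printed_exists_ne_zero_of_rowFrame hh hB hr
  · rw [if_neg hy.ne', if_pos hy] at hB
    have e : (w.2 + y : ℤ) = w.2 + (y.toNat : ℕ) := by rw [Int.toNat_of_nonneg hy.le]
    have e' : ((w.1 + k, w.2 + y) : Face) = (w.1 + k, w.2 + (y.toNat : ℕ)) := Prod.ext rfl e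
    rw [e'] at hr ⊢
    exact vertexFunctional_printed_exists_ne_zero_of_colFrame (by omega) hh hB hr

/-- ★★★★★ **THE EAST HALF-PLANE LAW WITH THE ZERO-COUNT BOUND**: for every `k ≥ 0`, `y ∈ ℤ` and every finite face list missing the hole and containing
`eastFrame w k y`, the zero set in `(0, π)` of the printed vertex functional at `(w.1 + k, w.2 + y)` is finite with at most `4·maxExp(Dl) − 4` elements.
[cite: GlazmanManolescu2019, Lemma 2.1 and eq. (1); Remark 2.2; §4.2] [cite: Glazman2015WeightedSAW, Lemma 3.1 (proof, pp. 6–7)] -/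
theorem vertexFunctional_printed_zero_set_finite_of_eastFrame {k : ℕ} {y : ℤ} (hh : holeFaceW w ∉ dom Dl) (hB : ∀ c ∈ eastFrame w k y, c ∈ Dl)
    (hr : RootedFace (dom Dl) (w.side .W) (w.1 + k, w.2 + y)) :
    {θ ∈ Set.Ioo 0 π | vertexFunctional (printedWeights θ) tFiveEighths (ybCoeff θ) Dl (w.side .W) (w.1 + k, w.2 + y) = 0}.Finite ∧
      {θ ∈ Set.Ioo 0 π | vertexFunctional (printedWeights θ) tFiveEighths (ybCoeff θ) Dl (w.side .W) (w.1 + k, w.2 + y) = 0}.ncard ≤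
        4 * maxExp Dl (w.side .W) (w.1 + k, w.2 + y) + 1 - 5 := by
  unfold eastFrame at hB
  rcases lt_trichotomy y 0 with hy | rfl | hy
  · rw [if_neg hy.ne, if_neg (not_lt.2 hy.le)] at hB
    have e : (w.2 + y : ℤ) = w.2 - ((-y).toNat : ℕ) := by rw [Int.toNat_of_nonneg (by omega)]; ring
    have e' : ((w.1 + k, w.2 + y) : Face) = (w.1 + k, w.2 - ((-y).toNat : ℕ)) := Prod.ext rfl e
    rw [e'] at hr ⊢
    exact vertexFunctional_printed_zero_set_finite_of_colFrame_below' (by omega) hh hB hr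
  · rw [if_pos rfl] at hB
    have e' : ((w.1 + k, w.2 + (0 : ℤ)) : Face) = (w.1 + k, w.2) := Prod.ext rfl (add_zero _)
    rw [e'] at hr ⊢
    exact vertexFunctional_printed_zero_set_finite_of_rowFrame hh hB hr
  · rw [if_neg hy.ne', if_pos hy] at hB
    have e : (w.2 + y : ℤ) = w.2 + (y.toNat : ℕ) := by rw [Int.toNat_of_nonneg hy.le]
    have e' : ((w.1 + k, w.2 + y) : Face) = (w.1 + k, w.2 + (y.toNat : ℕ)) := Prod.ext rfl e
    rw [e'] at hr ⊢
    exact vertexFunctional_printed_zero_set_finite_of_colFrame (by omega) hh hB hr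

end Literature.Barriers.CriticalPhenomena.PlaquetteWalk
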